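import Summits.CriticalPhenomena.PercolationContinuityZ3.Theorems.SubpolynomialBlocking.Negative.OffCritical
import Literature.Probability.Percolation.BKFinitary
import Literature.Probability.Percolation.ClusterBoundary
import Literature.Probability.Percolation.PlanarDuality
import Literature.Probability.Percolation.HalfSpaceBrickSymmetry
import Literature.Probability.Percolation.SharpnessDCTProofs
import HarnessLib

/-!
# `SubpolynomialBlocking`, line `SketchIdeator5` — stub `stub_productFloor`: the two-sided charging floor

Support file for crux item stmt-CriticalPhenomena-4446 (`PercNonProliferation.SubpolynomialBlocking`:
`∀ s > 0, ∀ᶠ n, n^{-s} ≤ u_n`, `u_n = P_{p_c(ℤ³)}(Λ_n ↮ ∂ⁱⁿΛ_{2n} inside Λ_{2n})`), line `SketchIdeator5`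
(card `Ideas/two-sided-charging-floor.md`, MEMO-ideator5-r2 §2), lead a1. The registered stub proved here:

  `stub_productFloor : ∀ p, ∀ n ≥ 1, ∏_{v ∈ ∂ⁱⁿΛ_m} (1 - P_p(inArm v n) · P_p(outArm v n)) ≤ u_n(p)`,

`m = n + ⌊n/2⌋`, `inArm v n = {∃ x ∈ Λ_n, v ↔ x inside Λ_m}`, `outArm v n = {∃ y ∈ ∂ⁱⁿΛ_{2n}, v ↔ y inside Λ_{2n}}`.
It is dimension-free (`ProductFloor.prod_le_blockProb`, every `d`) and holds at every `p`.

Proof (van den Berg–Kesten + Harris, Grimmett 1999 Thm (2.4), (2.17)):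
* FIRST EXIT (`ProductFloor.exists_firstExit`, `…mem_disjointOccurrence_of_crossing`): an open lattice PATH
  (`exists_walk_of_mem_openConnIn` + `Walk.bypass`) from `x ∈ Λ_n` to `y ∈ ∂ⁱⁿΛ_{2n}` leaves `Λ_m` (`m < 2n`);
  cut it at its first exit edge `a ∼ b` (`a ∈ Λ_m`, `b ∉ Λ_m`, so `a ∈ ∂ⁱⁿΛ_m`): the initial segment is an open walk
  inside `Λ_m` from `x` to `a` — a witness of `inArm a n` — and the remainder an open walk inside `Λ_{2n}` from `a`
  to `y` — a witness of `outArm a n`; a path repeats no edge, so the two witnesses are DISJOINT: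
  `Cross_n ⊆ ⋃_{v ∈ ∂ⁱⁿΛ_m} inArm v n □ outArm v n` on lattice configurations.
* BK for the finitary increasing events `inArm`, `outArm` (`bk_finitary`, `isFinitary_openConnIn`):
  `P(inArm v □ outArm v) ≤ P(inArm v) P(outArm v)`.
* HARRIS for the decreasing complements (`prob_biInter_ge_prod_of_isLowerSet`):
  `u_n ≥ P(⋂_v (inArm v □ outArm v)ᶜ) ≥ ∏_v (1 - P(inArm v □ outArm v)) ≥ ∏_v (1 - P(inArm v) P(outArm v))`.
-/

noncomputable section

namespace Summit.CriticalPhenomena.PercolationContinuityZ3.Theorems.SubpolynomialBlocking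

open MeasureTheory Filter Topology
open Literature.Probability.Percolation Literature.Probability.LatticeModels
open Literature.Probability.Percolation.DCT16
open Literature.Barriers.CriticalPhenomena
open Summit.CriticalPhenomena.PercolationContinuityZ3.Theorems.SubpolynomialBlocking.Negative
open scoped Literature.Probability.Percolation

namespace ProductFloor

/-! ## §1 Walks: the first exit decomposition -/

/-- **First exit of a walk.** A walk from a vertex of `B` to a vertex outside `B` splits at its first
exit edge `a ∼ b` (`a ∈ B`, `b ∉ B`) into an initial segment inside `B` and a remainder. -/
theorem exists_firstExit {V : Type*} {G : SimpleGraph V} (B : Set V) :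
    ∀ {u w : V} (p : G.Walk u w), u ∈ B → w ∉ B →
      ∃ (a b : V) (hab : G.Adj a b) (q : G.Walk u a) (r : G.Walk b w),
        a ∈ B ∧ b ∉ B ∧ (∀ z ∈ q.support, z ∈ B) ∧ p = q.append (SimpleGraph.Walk.cons hab r)
  | _, _, SimpleGraph.Walk.nil, hu, hw => absurd hu hw
  | u, _, SimpleGraph.Walk.cons (v := v') h p', hu, hw => by
      by_cases hv' : v' ∈ B
      · obtain ⟨a, b, hab, q, r, ha, hb, hq, rfl⟩ := exists_firstExit B p' hv' hw
        refine ⟨a, b, hab, SimpleGraph.Walk.cons h q, r, ha, hb, ?_, rfl⟩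
        intro z hz
        rw [SimpleGraph.Walk.support_cons, List.mem_cons] at hz
        rcases hz with rfl | hz
        · exact hu
        · exact hq z hz
      · exact ⟨u, v', h, SimpleGraph.Walk.nil, p', hu, hv', by simp [hu], rfl⟩

/-! ## §2 The events: monotonicity, finitarity, measurability -/

variable {d : ℕ}

/-- `inArm`-type events `{∃ x ∈ T, v ↔ x in S}` are increasing. -/
theorem isUpperSet_exists_openConnIn (S : Set (Site d)) (T : Finset (Site d)) (v : Site d) :
    IsUpperSet {ω : BondConfig (Site d) | ∃ x ∈ T, ω ∈ openConnIn S v x} := by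
  rintro ω ω' hle ⟨x, hx, hω⟩
  exact ⟨x, hx, isUpperSet_openConnIn S v x hle hω⟩

/-- `inArm`-type events `{∃ x ∈ T, v ↔ x in S}` are finitary (an open path has finitely many edges). -/
theorem isFinitary_exists_openConnIn (S : Set (Site d)) (T : Finset (Site d)) (v : Site d) :
    IsFinitary {ω : BondConfig (Site d) | ∃ x ∈ T, ω ∈ openConnIn S v x} := by
  classical
  rintro ω ⟨x, hx, hω⟩
  obtain ⟨K, hKω, hK⟩ := isFinitary_openConnIn S v x ω hω
  exact ⟨K, hKω, x, hx, hK⟩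

/-- `inArm`-type events are measurable. -/
theorem measurableSet_exists_openConnIn (S : Set (Site d)) (T : Finset (Site d)) (v : Site d) :
    MeasurableSet {ω : BondConfig (Site d) | ∃ x ∈ T, ω ∈ openConnIn S v x} :=
  (isFinitary_exists_openConnIn S T v).measurableSet (isUpperSet_exists_openConnIn S T v)

/-- The disjoint occurrence of two `inArm`-type events is measurable (finitary and increasing). -/
theorem measurableSet_disjointOccurrence (S S' : Set (Site d)) (T T' : Finset (Site d)) (v : Site d) :
    MeasurableSet ({ω : BondConfig (Site d) | ∃ x ∈ T, ω ∈ openConnIn S v x} □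
      {ω : BondConfig (Site d) | ∃ x ∈ T', ω ∈ openConnIn S' v x}) := by
  classical
  exact ((isFinitary_exists_openConnIn S T v).disjointOccurrence (isUpperSet_exists_openConnIn S T v)
    (isUpperSet_exists_openConnIn S' T' v) (isFinitary_exists_openConnIn S' T' v)).measurableSet
    ((isUpperSet_exists_openConnIn S T v).disjointOccurrence (isUpperSet_exists_openConnIn S' T' v))

/-! ## §3 The deterministic step: a crossing has a disjointly-armed first exit site on the mid-sphere -/

/-- **Crossing ⟹ disjoint in/out arms at some mid-sphere site** (lattice configurations, `n ≤ m < 2n`): if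
`x ∈ Λ_n` is joined to `y ∈ ∂ⁱⁿΛ_{2n}` inside `Λ_{2n}`, then for some `v ∈ ∂ⁱⁿΛ_m` the events
`{∃ x' ∈ Λ_n, v ↔ x' in Λ_m}` and `{∃ y' ∈ ∂ⁱⁿΛ_{2n}, v ↔ y' in Λ_{2n}}` occur disjointly. -/
theorem mem_disjointOccurrence_of_crossing {n m : ℕ} (hnm : n ≤ m) (hm : m < 2 * n)
    {ω : BondConfig (Site d)} (hω : ω ⊆ (zdGraph d).edgeSet) {x y : Site d} (hx : x ∈ box d n)
    (hy : y ∈ innerBoundary (zdGraph d) (box d (2 * n)))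
    (hxy : ω ∈ openConnIn (↑(box d (2 * n)) : Set (Site d)) x y) :
    ∃ v ∈ innerBoundary (zdGraph d) (box d m),
      ω ∈ ({ω : BondConfig (Site d) | ∃ x' ∈ box d n, ω ∈ openConnIn (↑(box d m) : Set (Site d)) v x'} □
        {ω : BondConfig (Site d) | ∃ y' ∈ innerBoundary (zdGraph d) (box d (2 * n)),
          ω ∈ openConnIn (↑(box d (2 * n)) : Set (Site d)) v y'}) := by
  classical
  -- an open lattice path from `x` to `y` inside `Λ_{2n}`
  obtain ⟨p₀, hp₀S, hp₀ω⟩ := exists_walk_of_mem_openConnIn hω hxy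
  set p := p₀.bypass with hp
  have hpS : ∀ z ∈ p.support, z ∈ (↑(box d (2 * n)) : Set (Site d)) :=
    fun z hz => hp₀S z (p₀.support_bypass_subset_support hz)
  have hpω : ∀ e ∈ p.edges, e ∈ ω := fun e he => hp₀ω e (p₀.edges_bypass_subset_edges he)
  have hpath : p.IsPath := p₀.bypass_isPath
  -- first exit from `Λ_m`
  have hxm : x ∈ (↑(box d m) : Set (Site d)) := Finset.mem_coe.2 (box_mono d hnm hx)
  have hym : y ∉ (↑(box d m) : Set (Site d)) := fun h =>
    notMem_box_of_mem_innerBoundary_box hm hy (Finset.mem_coe.1 h)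
  obtain ⟨a, b, hab, q, r, ha, hb, hq, hpqr⟩ := exists_firstExit (↑(box d m) : Set (Site d)) p hxm hym
  have ha' : a ∈ innerBoundary (zdGraph d) (box d m) :=
    mem_innerBoundary_iff.2 ⟨Finset.mem_coe.1 ha, b, fun h => hb (Finset.mem_coe.2 h), hab⟩
  refine ⟨a, ha', ?_⟩
  -- the two witnesses
  set K : Set (Sym2 (Site d)) := {e | e ∈ q.edges} with hK
  set L : Set (Sym2 (Site d)) := {e | e ∈ (SimpleGraph.Walk.cons hab r).edges} with hL
  have hedges : p.edges = q.edges ++ (SimpleGraph.Walk.cons hab r).edges := by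
    rw [hpqr, SimpleGraph.Walk.edges_append]
  have hKω : K ⊆ ω := fun e he => hpω e (by rw [hedges]; exact List.mem_append_left _ he)
  have hLω : L ⊆ ω := fun e he => hpω e (by rw [hedges]; exact List.mem_append_right _ he)
  have hdisj : Disjoint K L := by
    have hnd : (q.edges ++ (SimpleGraph.Walk.cons hab r).edges).Nodup := by
      rw [← hedges]; exact hpath.isTrail.edges_nodup
    rw [Set.disjoint_left]
    intro e heK heL
    exact List.disjoint_of_nodup_append hnd heK heL
  -- `K` witnesses the inward arm at `a` (walk `q` reversed, inside `Λ_m`, ending at `x ∈ Λ_n`)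
  have hKA : K ∈ {ω : BondConfig (Site d) | ∃ x' ∈ box d n, ω ∈ openConnIn (↑(box d m) : Set (Site d)) a x'} := by
    refine ⟨x, hx, mem_openConnIn_of_walk q.reverse (fun z hz => ?_) (fun e he => ?_)⟩
    · rw [SimpleGraph.Walk.support_reverse, List.mem_reverse] at hz
      exact hq z hz
    · rw [SimpleGraph.Walk.edges_reverse, List.mem_reverse] at he
      exact he
  -- `L` witnesses the outward arm at `a` (walk `a ∼ b ⋯ y` inside `Λ_{2n}`)
  have hLB : L ∈ {ω : BondConfig (Site d) | ∃ y' ∈ innerBoundary (zdGraph d) (box d (2 * n)),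
      ω ∈ openConnIn (↑(box d (2 * n)) : Set (Site d)) a y'} := by
    refine ⟨y, hy, mem_openConnIn_of_walk (SimpleGraph.Walk.cons hab r) (fun z hz => ?_) (fun e he => he)⟩
    refine hpS z ?_
    rw [hpqr, SimpleGraph.Walk.mem_support_append_iff]
    exact Or.inr hz
  exact ((isUpperSet_exists_openConnIn _ _ a).mem_disjointOccurrence_iff
    (isUpperSet_exists_openConnIn _ _ a) ω).2 ⟨K, hKω, L, hLω, hdisj, hKA, hLB⟩

/-! ## §4 The probabilistic assembly (every `d`, every `p`) -/

/-- **The two-sided charging floor, general dimension**: for `n ≤ m < 2n` and every `p`,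
`∏_{v ∈ ∂ⁱⁿΛ_m} (1 - P_p(∃ x ∈ Λ_n, v ↔ x in Λ_m) · P_p(∃ y ∈ ∂ⁱⁿΛ_{2n}, v ↔ y in Λ_{2n})) ≤ u_n(d, p)`.
Harris over the decreasing complements of the disjoint-occurrence events of §3, then BK termwise. -/
theorem prod_le_blockProb (p : unitInterval) {n m : ℕ} (hnm : n ≤ m) (hm : m < 2 * n) :
    ∏ v ∈ innerBoundary (zdGraph d) (box d m),
        (1 - (bondPercolation (zdGraph d) p).real
              {ω | ∃ x ∈ box d n, ω ∈ openConnIn (↑(box d m) : Set (Site d)) v x} *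
            (bondPercolation (zdGraph d) p).real
              {ω | ∃ y ∈ innerBoundary (zdGraph d) (box d (2 * n)),
                ω ∈ openConnIn (↑(box d (2 * n)) : Set (Site d)) v y}) ≤
      blockProb d p n := by
  classical
  set μ := bondPercolation (zdGraph d) p with hμ
  set A : Site d → Set (BondConfig (Site d)) := fun v =>
    {ω | ∃ x ∈ box d n, ω ∈ openConnIn (↑(box d m) : Set (Site d)) v x} with hA
  set B : Site d → Set (BondConfig (Site d)) := fun v =>
    {ω | ∃ y ∈ innerBoundary (zdGraph d) (box d (2 * n)),
      ω ∈ openConnIn (↑(box d (2 * n)) : Set (Site d)) v y} with hB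
  set D : Site d → Set (BondConfig (Site d)) := fun v => (A v □ B v)ᶜ with hD
  have hAup : ∀ v, IsUpperSet (A v) := fun v => isUpperSet_exists_openConnIn _ _ v
  have hBup : ∀ v, IsUpperSet (B v) := fun v => isUpperSet_exists_openConnIn _ _ v
  have hAf : ∀ v, IsFinitary (A v) := fun v => isFinitary_exists_openConnIn _ _ v
  have hBf : ∀ v, IsFinitary (B v) := fun v => isFinitary_exists_openConnIn _ _ v
  have hABm : ∀ v, MeasurableSet (A v □ B v) := fun v => measurableSet_disjointOccurrence _ _ _ _ v
  -- Harris for the decreasing `D v`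
  have h1 : ∏ v ∈ innerBoundary (zdGraph d) (box d m), μ.real (D v) ≤
      μ.real (⋂ v ∈ innerBoundary (zdGraph d) (box d m), D v) :=
    prob_biInter_ge_prod_of_isLowerSet (zdGraph d) p _ D
      (fun v _ => ((hAup v).disjointOccurrence (hBup v)).compl) (fun v _ => (hABm v).compl)
  -- `⋂_v D v ⊆ blockEv` almost surely
  have h2 : μ.real (⋂ v ∈ innerBoundary (zdGraph d) (box d m), D v) ≤ blockProb d p n := by
    refine real_mono_of_forall_subset_edgeSet (zdGraph d) p fun ω hω hωD => ?_
    rintro ⟨x, hx, y, hy, hxy⟩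
    obtain ⟨v, hv, hvω⟩ := mem_disjointOccurrence_of_crossing hnm hm hω hx hy hxy
    exact (Set.mem_iInter₂.1 hωD) v hv hvω
  -- termwise BK
  have h3 : ∀ v, 1 - μ.real (A v) * μ.real (B v) ≤ μ.real (D v) := by
    intro v
    have hc : μ.real (D v) = 1 - μ.real (A v □ B v) := probReal_compl_eq_one_sub (hABm v)
    rw [hc]
    linarith [bk_finitary (zdGraph d) p (hAup v) (hBup v) (hAf v) (hBf v)]
  have h0 : ∀ v, 0 ≤ 1 - μ.real (A v) * μ.real (B v) := fun v => by
    have := mul_le_one₀ (measureReal_le_one (μ := μ) (s := A v)) measureReal_nonneg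
      (measureReal_le_one (μ := μ) (s := B v))
    linarith
  calc ∏ v ∈ innerBoundary (zdGraph d) (box d m), (1 - μ.real (A v) * μ.real (B v))
      ≤ ∏ v ∈ innerBoundary (zdGraph d) (box d m), μ.real (D v) :=
        Finset.prod_le_prod (fun v _ => h0 v) fun v _ => h3 v
    _ ≤ μ.real (⋂ v ∈ innerBoundary (zdGraph d) (box d m), D v) := h1
    _ ≤ blockProb d p n := h2

end ProductFloor

/-- **Stub `stub_productFloor`** (crux stmt-CriticalPhenomena-4446, line `SketchIdeator5`): THE TWO-SIDED CHARGING FLOOR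
on `ℤ³` — for every `p` and `n ≥ 1`, with `m = n + ⌊n/2⌋`,
`∏_{v ∈ ∂ⁱⁿΛ_m} (1 - P_p(inArm v n) · P_p(outArm v n)) ≤ P_p(Λ_n ↮ ∂ⁱⁿΛ_{2n} inside Λ_{2n})`
(`ProductFloor.prod_le_blockProb` at `d = 3`, `m = n + ⌊n/2⌋`, using `n ≤ m < 2n` for `n ≥ 1`). -/
theorem stub_productFloor :
    ∀ (p : unitInterval) (n : ℕ), 1 ≤ n →
      ∏ v ∈ innerBoundary (zdGraph 3) (box 3 (n + n / 2)),
          (1 - (bondPercolation (zdGraph 3) p).real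
                {ω | ∃ x ∈ box 3 n, ω ∈ openConnIn (↑(box 3 (n + n / 2)) : Set (Site 3)) v x} *
              (bondPercolation (zdGraph 3) p).real
                {ω | ∃ y ∈ innerBoundary (zdGraph 3) (box 3 (2 * n)),
                  ω ∈ openConnIn (↑(box 3 (2 * n)) : Set (Site 3)) v y}) ≤
        (bondPercolation (zdGraph 3) p).real
          {ω | ¬ ∃ x ∈ box 3 n, ∃ y ∈ innerBoundary (zdGraph 3) (box 3 (2 * n)),
            ω ∈ openConnIn (↑(box 3 (2 * n)) : Set (Site 3)) x y} :=
  fun p n hn => ProductFloor.prod_le_blockProb (d := 3) p (Nat.le_add_right n (n / 2)) (by omega)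

end Summit.CriticalPhenomena.PercolationContinuityZ3.Theorems.SubpolynomialBlocking

end
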